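import Summits.CriticalPhenomena.PercolationContinuityZ3.Theorems.FreeBoxPowerSaving.Negative.FreeBoxPowerSavingProfile
import Literature.Probability.Percolation.CriticalContinuityProofs

/-!
# Negative / tightness lemmas for the crux `FreeBoxPowerSaving` (stmt-CriticalPhenomena-4447), VI:
# load-bearing guards of the registered stubs, and the sibling skeleton's confined-cluster stub

Supports (does not close) the crux `PercNonProliferation.FreeBoxPowerSaving`.  Standing-disprover
(cdisprove cycle 3) audit of the checked skeleton `Lines/tightness-collapse-typical-kmax.lean`
(`c888e645…`) and of the archived sibling `Lines/boundary-interior-split-fat-finite-clusters.lean`,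
landed from `Cruxes/FreeBoxPowerSaving/Disproof.lean` §11; sorry-free; events VERBATIM as registered.

* `exists_piece_ge_eq_univ_of_le_one` — `{∃ u ∈ B(n), #C_n(u) ≥ t}` is sure for `t ≤ 1`.
* `sizeSplitting_of_le_one` — the guard `1 ≤ s` of `stub_sizeSplitting` is NOT load-bearing: for
  `s ≤ 1` its right-hand side is `1`, so the guard-free version is equivalent.
* `logBoost_hypothesis_false_of_three_le` — for `a ≥ 3` the second hypothesis of `stub_logBoost`
  is unsatisfiable (vacuous truth there); any use has `a < 3`.
* `gluingCriterion_false_without_guard` — the guard `1 ≤ n` of `stub_gluingCriterion` IS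
  load-bearing: without it the criterion is FALSE (`n = 0`, `s = 0`, `p = 0`: good event sure, `θ(0) = 0`).
* `openConn_inter_confined_subset_openConnIn`, `fatFiniteClusters_of_freeBoxPowerSaving` — the sibling
  skeleton's distinctive open stub `stub_fatFiniteClusters` (`Σ_{y∈B(2n)} P_{p_c}(0 ↔ y, C(0) ⊆ B(2n))
  ≤ C n^{3-a}`) VERBATIM from the crux: a confined cluster joins inside the box, and the crux is a
  centred free-box bound with exponent `3 - a` (`freeBoxPowerSaving_iff_centredPowerSaving`).
-/

namespace Summit.CriticalPhenomena.PercolationContinuityZ3.FreeBoxPowerSavingNegative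

open MeasureTheory ProbabilityTheory Filter
open Literature.Probability.Percolation Literature.Probability.LatticeModels
open Summit.CriticalPhenomena.PercolationContinuityZ3.Theses.PercNonProliferation
open scoped BigOperators Topology Classical

noncomputable section

/-! ## Load-bearing guards of the registered stubs -/

/-- `{∃ u ∈ B(n), #C_n(u) ≥ t}` is the sure event for `t ≤ 1` (every vertex is its own piece). -/
theorem exists_piece_ge_eq_univ_of_le_one (n : ℕ) {t : ℝ} (ht : t ≤ 1) :
    {ω : BondConfig (Site 3) | ∃ u ∈ box 3 n,
      t ≤ (((box 3 n).filter fun v => ω ∈ openConnIn ↑(box 3 n) u v).card : ℝ)} = Set.univ := by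
  refine Set.eq_univ_of_forall fun ω => ⟨0, zero_mem_box 3 n, ht.trans ?_⟩
  have h0 : (0 : Site 3) ∈ (box 3 n).filter fun v => ω ∈ openConnIn ↑(box 3 n) 0 v := by
    rw [Finset.mem_filter]
    exact ⟨zero_mem_box 3 n, Finset.mem_coe.2 (zero_mem_box 3 n), Finset.mem_coe.2 (zero_mem_box 3 n),
      SimpleGraph.Reachable.refl _⟩
  exact_mod_cast Finset.card_pos.2 ⟨0, h0⟩

/-- **The guard `1 ≤ s` of `stub_sizeSplitting` is not load-bearing**: for `s ≤ 1` the size-splitting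
inequality holds at every `p, n` because its right-hand side is `1`.  (So the registered stub is
equivalent to its guard-free version; provers may use either.) -/
theorem sizeSplitting_of_le_one (p : unitInterval) (n : ℕ) {s : ℝ} (hs : s ≤ 1) :
    (bondPercolation (zdGraph 3) p).real
        {ω | ∃ u ∈ box 3 n,
          3 * s ≤ (((box 3 n).filter fun v => ω ∈ openConnIn ↑(box 3 n) u v).card : ℝ)}
      ≤ ((bondPercolation (zdGraph 3) p).real
          {ω | ∃ u ∈ box 3 n,
            s ≤ (((box 3 n).filter fun v => ω ∈ openConnIn ↑(box 3 n) u v).card : ℝ)}) ^ 2 := by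
  have huniv : {ω : BondConfig (Site 3) | ∃ u ∈ box 3 n,
      s ≤ (((box 3 n).filter fun v => ω ∈ openConnIn ↑(box 3 n) u v).card : ℝ)} = Set.univ :=
    exists_piece_ge_eq_univ_of_le_one n hs
  rw [huniv, probReal_univ, one_pow]
  exact measureReal_le_one

/-- **For `a ≥ 3` the second hypothesis of `stub_logBoost` is unsatisfiable** (`n^{3-a} ≤ 1` for
`n ≥ 1`, so `QG(n, n^{3-a})` is sure and its probability `1` is not `≤ 1 - ε`): any application of
the log boost has `a < 3`. -/
theorem logBoost_hypothesis_false_of_three_le (p : unitInterval) {a ε : ℝ} (ha : 3 ≤ a) (hε : 0 < ε) :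
    ¬ ∀ᶠ n : ℕ in atTop,
      (bondPercolation (zdGraph 3) p).real
        {ω | ∃ u ∈ box 3 n, (n : ℝ) ^ (3 - a) ≤
          (((box 3 n).filter fun v => ω ∈ openConnIn ↑(box 3 n) u v).card : ℝ)} ≤ 1 - ε := by
  intro h
  obtain ⟨n, hn, hn1⟩ := (h.and (eventually_ge_atTop 1)).exists
  have hn1' : (1 : ℝ) ≤ n := by exact_mod_cast hn1
  have hle : (n : ℝ) ^ (3 - a) ≤ 1 := Real.rpow_le_one_of_one_le_of_nonpos hn1' (by linarith)
  have huniv : {ω : BondConfig (Site 3) | ∃ u ∈ box 3 n, (n : ℝ) ^ (3 - a) ≤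
      (((box 3 n).filter fun v => ω ∈ openConnIn ↑(box 3 n) u v).card : ℝ)} = Set.univ :=
    exists_piece_ge_eq_univ_of_le_one n hle
  rw [huniv, probReal_univ] at hn
  linarith

/-- **The guard `1 ≤ n` of `stub_gluingCriterion` is load-bearing**: without it the criterion is
FALSE — at `n = 0`, `s = 0` the good event `QG(0,0) ∩ Glued(0,0)` is sure (`B(0) = B(2·0) = {0}`),
so it has `P_0`-probability `1 > 1 - ε₀`, while `θ(0) = 0`. -/
theorem gluingCriterion_false_without_guard :
    ¬ ∃ ε₀ : ℝ, 0 < ε₀ ∧ ∀ (p : unitInterval) (n : ℕ) (s : ℝ),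
      1 - ε₀ < (bondPercolation (zdGraph 3) p).real
        ({ω | ∃ u ∈ box 3 n,
            s ≤ (((box 3 n).filter fun v => ω ∈ openConnIn ↑(box 3 n) u v).card : ℝ)} ∩
         {ω | ∀ u ∈ box 3 n, ∀ u' ∈ box 3 (2 * n),
            s ≤ (((box 3 n).filter fun v => ω ∈ openConnIn ↑(box 3 n) u v).card : ℝ) →
            s ≤ (((box 3 (2 * n)).filter fun v => ω ∈ openConnIn ↑(box 3 (2 * n)) u' v).card : ℝ) →
            ω ∈ openConnIn ↑(box 3 (2 * n)) u u'}) →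
      0 < theta (zdGraph 3) (0 : Site 3) p := by
  rintro ⟨ε₀, hε₀, h⟩
  have hbox0 : ∀ u : Site 3, u ∈ box 3 0 → u = 0 := by
    intro u hu
    rw [mem_box] at hu
    funext i
    have := hu i
    push_cast at this
    simp only [Pi.zero_apply]
    omega
  have huniv : ({ω : BondConfig (Site 3) | ∃ u ∈ box 3 0,
      (0 : ℝ) ≤ (((box 3 0).filter fun v => ω ∈ openConnIn ↑(box 3 0) u v).card : ℝ)} ∩
      {ω | ∀ u ∈ box 3 0, ∀ u' ∈ box 3 (2 * 0),
        (0 : ℝ) ≤ (((box 3 0).filter fun v => ω ∈ openConnIn ↑(box 3 0) u v).card : ℝ) →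
        (0 : ℝ) ≤ (((box 3 (2 * 0)).filter fun v => ω ∈ openConnIn ↑(box 3 (2 * 0)) u' v).card : ℝ) →
        ω ∈ openConnIn ↑(box 3 (2 * 0)) u u'}) = Set.univ := by
    refine Set.eq_univ_of_forall fun ω => ⟨⟨0, zero_mem_box 3 0, Nat.cast_nonneg _⟩, ?_⟩
    intro u hu u' hu' _ _
    have h20 : 2 * 0 = 0 := rfl
    rw [h20] at hu' ⊢
    rw [hbox0 u hu, hbox0 u' hu']
    exact ⟨Finset.mem_coe.2 (zero_mem_box 3 0), Finset.mem_coe.2 (zero_mem_box 3 0),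
      SimpleGraph.Reachable.refl _⟩
  have h1 := h 0 0 0
  rw [huniv, probReal_univ] at h1
  have hθ : 0 < theta (zdGraph 3) (0 : Site 3) 0 := h1 (by linarith)
  have hpc : ((0 : unitInterval) : ℝ) < criticalProb (zdGraph 3) (0 : Site 3) := by
    exact_mod_cast criticalProb_zd_pos 3 (by norm_num)
  have hzero : theta (zdGraph 3) (0 : Site 3) 0 = 0 :=
    theta_eq_zero_of_lt_criticalProb_holds (zdGraph 3) (0 : Site 3) 0 hpc
  linarith

/-! ## The archived sibling skeleton's confined-cluster stub is crux-necessary -/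

/-- A cluster confined to `S` joins its points inside `S`:
`{0 ↔ y} ∩ {C(0) ⊆ S} ⊆ {0 ↔ y in S}`. -/
theorem openConn_inter_confined_subset_openConnIn (S : Set (Site 3)) (y : Site 3) :
    openConn (0 : Site 3) y ∩ {ω | openCluster ω 0 ⊆ S} ⊆ openConnIn S 0 y := by
  rintro ω ⟨hr, hS⟩
  apply DCT16.mem_openConnIn_of_pathIn
  refine ⟨hS (mem_openCluster_self ω 0), ?_⟩
  have hr' : Relation.ReflTransGen (openGraph ω).Adj 0 y := (SimpleGraph.reachable_iff_reflTransGen 0 y).1 hr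
  clear hr
  induction hr' with
  | refl => exact Relation.ReflTransGen.refl
  | @tail b c hb hbc ih =>
    refine ih.tail ⟨hbc, hS ?_⟩
    show (openGraph ω).Reachable 0 c
    exact ((SimpleGraph.reachable_iff_reflTransGen 0 b).2 hb).trans hbc.reachable

/-- **Crux ⟹ `stub_fatFiniteClusters`** (VERBATIM the sibling skeleton's distinctive open stub:
`Σ_{y ∈ B(2n)} P_{p_c}(0 ↔ y, C(0) ⊆ B(2n)) ≤ C n^{3-a}`): by confinement the summands are free-box
connectivities, and the crux is a centred free-box bound with exponent `b = 3 - a < 3`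
(`freeBoxPowerSaving_iff_centredPowerSaving`). -/
theorem fatFiniteClusters_of_freeBoxPowerSaving (h : FreeBoxPowerSaving) :
    ∃ a C : ℝ, 0 < a ∧ ∀ n : ℕ, 1 ≤ n →
      ∑ y ∈ box 3 (2 * n), (bondPercolation (zdGraph 3) (criticalProbI 3)).real
          (openConn 0 y ∩ {ω | openCluster ω 0 ⊆ ↑(box 3 (2 * n))})
        ≤ C * (n : ℝ) ^ (3 - a) := by
  obtain ⟨b, C, hb, hC⟩ := freeBoxPowerSaving_iff_centredPowerSaving.1 h
  refine ⟨3 - b, max C 0 * (2 : ℝ) ^ b, by linarith, fun n hn => ?_⟩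
  have hnpos : (0 : ℝ) < n := by exact_mod_cast hn
  have h2n : 1 ≤ 2 * n := by omega
  have h1 := hC (2 * n) h2n
  have h2 : ((2 * n : ℕ) : ℝ) ^ b = (2 : ℝ) ^ b * (n : ℝ) ^ b := by
    push_cast; exact Real.mul_rpow (by norm_num) hnpos.le
  calc ∑ y ∈ box 3 (2 * n), (bondPercolation (zdGraph 3) (criticalProbI 3)).real
          (openConn 0 y ∩ {ω | openCluster ω 0 ⊆ ↑(box 3 (2 * n))})
      ≤ ∑ y ∈ box 3 (2 * n), (bondPercolation (zdGraph 3) (criticalProbI 3)).real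
          (openConnIn (↑(box 3 (2 * n)) : Set (Site 3)) 0 y) :=
        Finset.sum_le_sum fun y _ =>
          measureReal_mono (openConn_inter_confined_subset_openConnIn _ y) (measure_ne_top _ _)
    _ ≤ C * ((2 * n : ℕ) : ℝ) ^ b := h1
    _ ≤ max C 0 * ((2 * n : ℕ) : ℝ) ^ b :=
        mul_le_mul_of_nonneg_right (le_max_left _ _) (Real.rpow_nonneg (by positivity) _)
    _ = max C 0 * (2 : ℝ) ^ b * (n : ℝ) ^ (3 - (3 - b)) := by rw [h2, sub_sub_cancel]; ring

end

end Summit.CriticalPhenomena.PercolationContinuityZ3.FreeBoxPowerSavingNegative
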